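/-
Copyright (c) 2026. All rights reserved.
Released under Apache 2.0 license as described in the file LICENSE.
-/
import Literature.AlgebraicGeometry.Pohlmann1968.DegenerateCMTypesAbelianCMFieldPrimePower
import HarnessLib

/-!
# The codimension of Lenstra's exceptional class is a power of `p`: `#ker χ = p^{k−j−1}` for an odd character
# vanishing on a CM type of an abelian group of order `2p^k`

Complement to `DegenerateCMTypesAbelianCMFieldPrimePower` (Lenstra's theorem, explicit, for abelian CM fields of
degree `2p^k`) and its group-level file `NumberTheory/ComplexMultiplication/DegenerateCMTypesAbelianPrimePower`:
the values of an odd character `χ` vanishing on a type are EXACTLY the `2p^{j+1}` numbers `±χ(u)^c` (`χ(u)` a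
primitive `p^{j+1}`-th root of unity of maximal level) and all fibres have the size of `ker χ`, so
`|G| = 2p^{j+1} · #ker χ`, `#ker χ = p^{k−j−1}`: the rational `(m,m)`-class outside `Dᵐ` which Pohlmann's
criterion extracts from the balanced set `ker χ ∪ ρu^{p^j} ker χ` has `m = p^a`, `a < k`.  (F. Hazama
[Hazama2003CyclicCM], Rem. 4.10: Lenstra's nondivisorial Hodge cycle; §5: weights `p`, `q`; B. B. Gordon
[Gordon1999HodgeAVSurvey], 9.2.2.)  THEOREMS ONLY.

## What is proved

* §1 **`card_eq_mul_card_ker`** (`|G| = 2p^{j+1} · #ker χ`), **`exists_card_ker_eq_pow`** (`#ker χ = p^a`, `a < k`,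
  for an odd character vanishing on a type of a group of order `2p^k`).
* §2 **`exists_exceptional_pow_of_not_isNondegenerate`**, **`exists_exceptional_pow_of_isSimple`** (a simple
  degenerate abelian `p^k`-fold with abelian CM carries a rational `(p^a, p^a)`-class outside `D^{p^a}`, `a < k`),
  `exists_exceptional_pow_of_isSimple_fiftyFour` (degree `54`: codimension `1, 3` or `9`).

## References

* [Hazama2003CyclicCM] F. Hazama, J. Math. Sci. Univ. Tokyo 10 (2003): Rem. 4.10, §5.
* [Gordon1999HodgeAVSurvey] B. B. Gordon, 9.2.2, §9.3.
* [Kubota1965] T. Kubota, Trans. AMS 118 (1965), §4 Lemma 2.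
* [Pohlmann1968] H. Pohlmann, Ann. of Math. 88 (1968), Thm. 1 and §3.

## Provenance

Lane `lit-hodgefound` (Track 2, Layer A3/B), seat `lit-hodgefound-p10` generation 35, row g35-#18; neighbours
cited by name, nothing restated: `DegenerateCMTypesAbelianPrimePower` (`exists_isPrimitiveRoot_of_sum_char_eq_zero`,
`exists_balanced_of_sum_char_eq_zero`, `card_fibre_mul`), `DegenerateCMTypesAbelianCMFieldPrimePower`
(`not_isNondegenerate_iff_exists_oddChar`), `MumfordSimpleFourfoldOfPrimitive` (`exists_exceptional_iff_of_primitive`).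
-/

open scoped BigOperators NumberField IsMulCommutative Classical
open CategoryTheory NumberField

namespace Literature.AlgebraicGeometry.Pohlmann1968

namespace AbelianPrimePower

open Literature.NumberTheory.ComplexMultiplication
open Literature.NumberTheory.ComplexMultiplication.CyclicCMType
open Literature.NumberTheory.ComplexMultiplication.CyclicCMType.AbelianPrimePow
open Literature.AlgebraicGeometry.Motives (AbelianVariety CMType)
open Literature.AlgebraicGeometry.HodgeTheory
open Literature.AlgebraicGeometry.VanGeemen1994 (hodgeClassSpan)
open Literature.AlgebraicGeometry.ComplexMultiplication (IsCMTypeRealisation isSimple_iff_isPrimitive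
  exists_isCMTypeRealisation)
open Literature.Barriers.HodgeConjecture (divisorClassesSpan)
open Literature.AlgebraicGeometry.Pohlmann1968.CyclicTwoOddPrimes (gal_comm isCMTypeWith_galType
  cmTypeRank_eq_typeRank_galType mem_galType_iff separating_of_forall_not_isStableUnder)
open Literature.AlgebraicGeometry.ComplexMultiplication.CyclicTwoPower (exists_conj_gal)

/-! ## §1 Group level: `#ker χ = p^{k−j−1}` -/

section Group

variable {G : Type*} [CommGroup G] [Fintype G] [DecidableEq G] {p : ℕ} [hp : Fact p.Prime] {ρ : G} {Φ : Finset G}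

omit [Fintype G] [DecidableEq G] hp in
/-- `χ(g^e) = χ(g)^e`. [folklore] -/
private theorem char_pow (χ : AddChar (Additive G) ℂ) (g : G) (e : ℕ) :
    χ (Additive.ofMul (g ^ e)) = χ (Additive.ofMul g) ^ e := by
  rw [ofMul_pow, AddChar.map_nsmul_eq_pow]

omit [Fintype G] [DecidableEq G] hp in
/-- `χ(gh) = χ(g)χ(h)`. [folklore] -/
private theorem char_mul (χ : AddChar (Additive G) ℂ) (g h : G) :
    χ (Additive.ofMul (g * h)) = χ (Additive.ofMul g) * χ (Additive.ofMul h) := by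
  rw [ofMul_mul, AddChar.map_add_eq_mul]

/-- **The image of `χ` has exactly `2p^{j+1}` elements `±χ(u)^c` and all fibres have size `#ker χ`, so
`|G| = 2p^{j+1} · #ker χ`.** [cite: Kubota1965, §4 Lemma 2 (proof)] -/
theorem card_eq_mul_card_ker (hp2 : p ≠ 2) (χ : AddChar (Additive G) ℂ) (hχ : χ (Additive.ofMul ρ) = -1)
    {u : G} {j : ℕ} (hu : IsPrimitiveRoot (χ (Additive.ofMul u)) (p ^ (j + 1)))
    (hall : ∀ g : G, χ (Additive.ofMul g) ^ (2 * p ^ (j + 1)) = 1) :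
    Fintype.card G = 2 * p ^ (j + 1) * (Finset.univ.filter fun d : G => χ (Additive.ofMul d) = 1).card := by
  set n := p ^ (j + 1) with hn
  set ω := χ (Additive.ofMul u) with hω
  set M := (Finset.univ.filter fun d : G => χ (Additive.ofMul d) = 1).card with hM
  -- the `2n` values
  set vals : Finset ℂ := (Finset.range n).image (fun c => ω ^ c) ∪ (Finset.range n).image (fun c => -ω ^ c)
    with hvals
  have hodd : Odd n := (hp.out.odd_of_ne_two hp2).pow
  have hinjv : Set.InjOn (fun c : ℕ => ω ^ c) ↑(Finset.range n) := fun c hc c' hc' hcc' =>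
    hu.pow_inj (Finset.mem_range.1 hc) (Finset.mem_range.1 hc') hcc'
  have hne : ∀ a b : ℕ, ω ^ a ≠ -ω ^ b := by
    intro a b hab
    have h1 : (ω ^ a) ^ n = 1 := by rw [← pow_mul, mul_comm, pow_mul, hu.pow_eq_one, one_pow]
    have h2 : (-ω ^ b) ^ n = -1 := by rw [hodd.neg_pow, ← pow_mul, mul_comm, pow_mul, hu.pow_eq_one, one_pow]
    rw [hab, h2] at h1
    norm_num at h1
  have hcardv : vals.card = 2 * n := by
    rw [hvals, Finset.card_union_of_disjoint, Finset.card_image_of_injOn hinjv,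
      Finset.card_image_of_injOn (fun c hc c' hc' hcc' => hinjv hc hc' (neg_injective hcc')), Finset.card_range,
      two_mul]
    rw [Finset.disjoint_left]
    intro v hv hv'
    obtain ⟨a, -, rfl⟩ := Finset.mem_image.1 hv
    obtain ⟨b, -, hb⟩ := Finset.mem_image.1 hv'
    exact hne a b hb.symm
  -- every value of `χ` lies in `vals`
  have hmem : ∀ g : G, χ (Additive.ofMul g) ∈ vals := by
    intro g
    have hsq : (χ (Additive.ofMul g) ^ n) ^ 2 = 1 := by rw [← pow_mul, mul_comm]; exact hall g
    rw [hvals, Finset.mem_union]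
    rcases sq_eq_one_iff.1 hsq with h1 | h1
    · obtain ⟨i, hi, he⟩ := hu.eq_pow_of_pow_eq_one h1
      exact Or.inl (Finset.mem_image.2 ⟨i, Finset.mem_range.2 hi, he⟩)
    · have h2 : (-χ (Additive.ofMul g)) ^ n = 1 := by rw [hodd.neg_pow, h1, neg_neg]
      obtain ⟨i, hi, he⟩ := hu.eq_pow_of_pow_eq_one h2
      refine Or.inr (Finset.mem_image.2 ⟨i, Finset.mem_range.2 hi, ?_⟩)
      rw [he, neg_neg]
  -- every fibre over `vals` has size `M`
  have hfib : ∀ v ∈ vals, (Finset.univ.filter fun d : G => χ (Additive.ofMul d) = v).card = M := by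
    intro v hv
    rw [hvals, Finset.mem_union] at hv
    rcases hv with hv | hv
    · obtain ⟨c, -, rfl⟩ := Finset.mem_image.1 hv
      rw [hM, ← card_fibre_mul χ (u ^ c) 1, char_pow, mul_one]
    · obtain ⟨c, -, rfl⟩ := Finset.mem_image.1 hv
      rw [hM, ← card_fibre_mul χ (ρ * u ^ c) 1, char_mul, char_pow, hχ, mul_one, neg_one_mul]
  -- partition of `G` by the fibres
  have hunion : (Finset.univ : Finset G) = vals.biUnion fun v => Finset.univ.filter fun d : G =>
      χ (Additive.ofMul d) = v := by
    ext g
    simp only [Finset.mem_univ, Finset.mem_biUnion, Finset.mem_filter, true_and, true_iff]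
    exact ⟨_, hmem g, rfl⟩
  have hcard := congrArg Finset.card hunion
  rw [Finset.card_univ, Finset.card_biUnion] at hcard
  · rw [hcard, Finset.sum_congr rfl hfib, Finset.sum_const, hcardv, smul_eq_mul]
  · intro v _ v' _ hvv'
    rw [Function.onFun, Finset.disjoint_filter]
    intro d _ h1 h2
    exact hvv' (h1.symm.trans h2)

/-- **`#ker χ = p^{k−j−1}` on a group of order `2p^k`**, for an odd character vanishing on a type (with `χ(u)` a
primitive `p^{j+1}`-th root of unity of maximal level): the codimension of Lenstra's exceptional class is a POWER
OF `p`, at most `p^{k−1}`. [cite: Kubota1965, §4 Lemma 2 (proof)] [cite: Hazama2003CyclicCM, Rem. 4.10 and §5] -/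
theorem exists_card_ker_eq_pow (hp2 : p ≠ 2) {k : ℕ} (hcard : Fintype.card G = 2 * p ^ k)
    (h : IsCMTypeWith ρ (Φ : Set G)) (χ : AddChar (Additive G) ℂ) (hχ : χ (Additive.ofMul ρ) = -1)
    (h0 : ∑ s ∈ Φ, χ (Additive.ofMul s) = 0) :
    ∃ a : ℕ, a < k ∧ (Finset.univ.filter fun d : G => χ (Additive.ofMul d) = 1).card = p ^ a := by
  obtain ⟨u, j, hu, hall⟩ := exists_isPrimitiveRoot_of_sum_char_eq_zero hp2 hcard h χ h0
  have key := card_eq_mul_card_ker hp2 χ hχ hu hall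
  rw [hcard, mul_assoc] at key
  have key' : p ^ k = p ^ (j + 1) * (Finset.univ.filter fun d : G => χ (Additive.ofMul d) = 1).card := by omega
  have hdvd : p ^ (j + 1) ∣ p ^ k := Dvd.intro _ key'.symm
  have hjk : j + 1 ≤ k := (Nat.pow_dvd_pow_iff_le_right hp.out.one_lt).1 hdvd
  refine ⟨k - (j + 1), by omega, ?_⟩
  have hpos : 0 < p ^ (j + 1) := pow_pos hp.out.pos _
  have e : p ^ k = p ^ (j + 1) * p ^ (k - (j + 1)) := by rw [← pow_add, Nat.add_sub_cancel' hjk]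
  rw [e] at key'
  exact (Nat.eq_of_mul_eq_mul_left hpos key').symm

end Group

/-! ## §2 Lenstra's exceptional class has codimension a power of `p` -/

section Field

variable {K : Type} [Field K] [NumberField K] [IsCMField K] [Normal ℚ K] [IsMulCommutative (K ≃ₐ[ℚ] K)]
variable {p : ℕ} [hp : Fact p.Prime] {k : ℕ} {ρ : K ≃ₐ[ℚ] K} {φ₀ : K →+* ℂ}
variable {Φ : CMType K} {A : AbelianVariety ℂ} {ι : 𝓞 K →+* End A} {θ : K →+* Module.End ℂ (complexBetti A.X 1)}

/-- **LENSTRA'S THEOREM with the codimension a power of `p`**: for an abelian CM field of degree `2p^k` (`p` odd),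
a CM type with no non-trivial stabiliser which is degenerate gives on every `A` of type `(K; Φ)` a rational
`(p^a, p^a)`-class outside `D^{p^a}(A) ⊗ ℂ` for some `a < k`. [cite: Hazama2003CyclicCM, Rem. 4.10 and §5]
[cite: Gordon1999HodgeAVSurvey, 9.2.2 and §9.3] [cite: Pohlmann1968, Thm. 1 and §3] -/
theorem exists_exceptional_pow_of_not_isNondegenerate (hp2 : p ≠ 2) (hρ : ∀ x, φ₀ (ρ x) = starRingEnd ℂ (φ₀ x))
    (hK : Module.finrank ℚ K = 2 * p ^ k)
    (hprim : ∀ u : K ≃ₐ[ℚ] K, u ≠ 1 →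
      ¬ IsStableUnder (Finset.univ.filter fun g : K ≃ₐ[ℚ] K => embOf φ₀ g ∈ Φ.1) u)
    (hdeg : ¬ IsNondegenerate Φ) (hA : IsCMTypeRealisation Φ A ι θ) :
    ∃ a : ℕ, a < k ∧
      ∃ c : complexBetti A.X (2 * p ^ a), IsRationalClass c ∧ IsOfHodgeType (p ^ k) A.X (2 * p ^ a) (p ^ a) (p ^ a) c ∧
        c ∉ divisorClassesSpan A.X (p ^ k) (p ^ a) := by
  have h := isCMTypeWith_galType hρ Φ
  have hcardG : Fintype.card (K ≃ₐ[ℚ] K) = 2 * p ^ k := by rw [card_gal_eq_finrank φ₀, hK]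
  have hinj := (embOf_bijective φ₀).1
  obtain ⟨χ, hχ, h0⟩ := (not_isNondegenerate_iff_exists_oddChar hρ Φ).1 hdeg
  obtain ⟨ΔG, hcardΔ, hbalΔ, h1, hρ1⟩ := exists_balanced_of_sum_char_eq_zero hp2 hcardG h χ hχ h0
  obtain ⟨a, hak, hMa⟩ := exists_card_ker_eq_pow hp2 hcardG h χ hχ h0
  rw [hMa] at hcardΔ
  refine ⟨a, hak, ?_⟩
  set Δ : Finset (K →+* ℂ) := ΔG.image (embOf φ₀) with hΔ
  have hcard : Δ.card = 2 * p ^ a := by rw [hΔ, Finset.card_image_of_injective _ hinj, hcardΔ]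
  have hbalG := (isBalanced_indicator_iff (Finset.univ.filter fun g : K ≃ₐ[ℚ] K => embOf φ₀ g ∈ Φ.1) ΔG).1 hbalΔ
  have hbal : IsGaloisBalanced Φ Δ := by
    rw [isGaloisBalanced_iff_two_mul]
    intro γ
    obtain ⟨δ, hδ⟩ := exists_algEquiv_comp_eq_smul φ₀ γ
    have hset : {s : K →+* ℂ | s ∈ Δ ∧ (γ : ℂ →+* ℂ).comp s ∈ Φ.1} =
        ↑((ΔG.filter fun d => δ⁻¹ * d ∈
          (Finset.univ.filter fun g : K ≃ₐ[ℚ] K => embOf φ₀ g ∈ Φ.1)).image (embOf φ₀)) := by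
      ext s
      simp only [Set.mem_setOf_eq, Finset.coe_image, Finset.coe_filter, Set.mem_image, hΔ, Finset.mem_image]
      constructor
      · rintro ⟨⟨d, hd, rfl⟩, hs⟩
        refine ⟨d, ⟨hd, ?_⟩, rfl⟩
        rw [mem_galType_iff, mul_comm, ← smul_embOf_of_comp φ₀ hδ, ringEquiv_smul_def]
        exact hs
      · rintro ⟨d, ⟨hd, hd'⟩, rfl⟩
        refine ⟨⟨d, hd, rfl⟩, ?_⟩
        rw [mem_galType_iff, mul_comm, ← smul_embOf_of_comp φ₀ hδ, ringEquiv_smul_def] at hd'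
        exact hd'
    rw [hset, Set.ncard_coe_finset, Finset.card_image_of_injective _ hinj, hcard, ← hcardΔ]
    exact hbalG δ⁻¹
  have hns : ∃ φ ∈ Δ, ComplexEmbedding.conjugate φ ∉ Δ := by
    refine ⟨embOf φ₀ 1, Finset.mem_image_of_mem _ h1, fun hc => hρ1 ?_⟩
    rw [conjugate_embOf gal_comm hρ, hΔ, Finset.mem_image] at hc
    obtain ⟨d', hd', he⟩ := hc
    rw [← hinj he]
    exact hd'
  have key := (exists_exceptional_iff_of_primitive hA (separating_of_forall_not_isStableUnder Φ hprim) (p ^ a)).2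
    ⟨Δ, ⟨hcard, hbal⟩, hns⟩
  rwa [CyclicPrimePower.finrank_div_two_eq hK] at key

omit hp in
/-- **Coordinate-free: every simple degenerate abelian `p^k`-fold with complex multiplication by an abelian CM
field of degree `2p^k` (`p` odd) carries a rational `(p^a, p^a)`-class outside `D^{p^a} ⊗ ℂ`, `a < k`.**
[cite: Hazama2003CyclicCM, Rem. 4.10] [cite: Gordon1999HodgeAVSurvey, §9.3 and 9.2.2] -/
theorem exists_exceptional_pow_of_isSimple (hprime : p.Prime) (hp2 : p ≠ 2) (hK : Module.finrank ℚ K = 2 * p ^ k)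
    (Φ : CMType K) (hA : IsCMTypeRealisation Φ A ι θ) (hs : A.IsSimple) (hdeg : ¬ IsNondegenerate Φ) :
    ∃ a : ℕ, a < k ∧
      ∃ c : complexBetti A.X (2 * p ^ a), IsRationalClass c ∧ IsOfHodgeType (p ^ k) A.X (2 * p ^ a) (p ^ a) (p ^ a) c ∧
        c ∉ divisorClassesSpan A.X (p ^ k) (p ^ a) := by
  haveI : Fact p.Prime := ⟨hprime⟩
  obtain ⟨φ₀⟩ := (inferInstance : Nonempty (K →+* ℂ))
  obtain ⟨ρ, hρall⟩ := exists_conj_gal (K := K)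
  exact exists_exceptional_pow_of_not_isNondegenerate hp2 (hρall φ₀) hK
    ((CyclicTwoOddPrimes.isSimple_iff φ₀ hA).1 hs) hdeg hA

/-- **Degree `54`, any abelian CM field: a simple degenerate `27`-fold carries a rational `(1,1)`-, `(3,3)`- or
`(9,9)`-class outside the corresponding `D`** — and a `(1,1)`-class outside `D¹` is impossible (`D¹ = B¹` by
Lefschetz), so the class has codimension `3` or `9` whenever `D¹(A) ⊗ ℂ` contains all rational `(1,1)`-classes.
[cite: Hazama2003CyclicCM, Rem. 4.10] [cite: Gordon1999HodgeAVSurvey, 9.2.2] -/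
theorem exists_exceptional_pow_of_isSimple_fiftyFour (hK : Module.finrank ℚ K = 54) (Φ : CMType K)
    (hA : IsCMTypeRealisation Φ A ι θ) (hs : A.IsSimple) (hdeg : ¬ IsNondegenerate Φ) :
    ∃ a : ℕ, a < 3 ∧
      ∃ c : complexBetti A.X (2 * 3 ^ a), IsRationalClass c ∧ IsOfHodgeType 27 A.X (2 * 3 ^ a) (3 ^ a) (3 ^ a) c ∧
        c ∉ divisorClassesSpan A.X 27 (3 ^ a) := by
  haveI : Fact (Nat.Prime 3) := ⟨Nat.prime_three⟩
  have hK' : Module.finrank ℚ K = 2 * 3 ^ 3 := by rw [hK]; norm_num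
  obtain ⟨a, ha, c, hc⟩ := exists_exceptional_pow_of_isSimple Nat.prime_three (by norm_num) hK' Φ hA hs hdeg
  exact ⟨a, ha, c, by simpa using hc⟩

end Field

end AbelianPrimePower

end Literature.AlgebraicGeometry.Pohlmann1968
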